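import Literature.Analysis.FluidPDE.VorticityStretching
import Literature.Analysis.FluidPDE.LerayProfileCalculus
import Literature.Analysis.FluidPDE.SelfSimilar
import Literature.Analysis.FluidPDE.SpaceTimeCalculus
import Literature.Analysis.FluidPDE.KNSSThm52Integrand

/-!
# Crux `FrequencyRigidity` (stmt-NavierStokesRegularity-2955), line `two-ended-pinning`:
# stub `stub_vorticitySqBounds` — `φ = ‖curl v‖²` is jointly smooth, with slab bounds

Helper file (`--supports stmt-NavierStokesRegularity-2955`; theorems only, no definitions, no named
facts) for the registered stub `stub_vorticitySqBounds` of the line's skeleton.  The line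
differentiates the adapted enstrophy `H(t) = ∫ ‖curl v(t)‖² K(t)` by a generic kernel-pairing lemma
applied to `φ(t, x) = ‖curl v(t, x)‖²`; this stub supplies that lemma's hypotheses on `φ` for a
classical Navier–Stokes flow `(v, q)` (any viscosity `ν`, zero force) on `(−∞, 0) × ℝ³` with the
time-Type-I bound `‖v(t, x)‖ ≤ C/√(−t)` and the scale-invariant bounds
`‖Dᵏv(t, x)‖ ≤ C'_k (−t)^{−(k+1)/2}`, `k ≥ 1`:

* `isSmoothSpaceTimeOn_norm_curl_sq` — `φ` is jointly smooth on `(−∞, 0) × ℝ³` (`curl = curlCLM ∘ D`,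
  the slice derivative of a jointly smooth field is jointly smooth, and `‖·‖²` is smooth);
* `stub_vorticitySqBounds` — on every slab `[a, b] × ℝ³`, `a < b < 0`, the four quantities `|φ|`,
  `‖Dφ‖`, `|Δφ|`, `|∂ₜφ|` are bounded by one constant: with `ω = curl v(t)`,
  `‖ω‖ ≤ ‖curlCLM‖ ‖Dv‖`, `‖Dω‖ ≤ ‖curlCLM‖ ‖D²v‖`, `‖Δω‖ ≤ 3‖D²ω‖ ≤ 3‖curlCLM‖ ‖D³v‖`,
  `Dφ = 2⟪ω, Dω ·⟫`, `Δφ = 2⟪Δω, ω⟫ + 2|Dω|²_F` (`laplacian_inner_self_eq`),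
  `∂ₜφ = 2⟪ω, curl ∂ₜv⟫` (exchange of `∂ₜ` and `D` on the open time set) with the vorticity
  equation `curl ∂ₜv = νΔω − (v·∇)ω + (ω·∇)v` (`IsClassicalNSSolutionOn.curl_timeDerivWithin_eq`),
  and every power `(−t)^{−α}`, `α ≥ 0`, is at most `(−b)^{−α}` on `[a, b]`.

## References

* A. J. Majda, A. L. Bertozzi, *Vorticity and incompressible flow*, CUP (2002), §1.1 and
  eq. (1.33) (the vorticity equation). [MajdaBertozziCUP2002]
* G. Koch, N. Nadirashvili, G. Seregin, V. Šverák, Acta Math. 203 (2009), §4–§5 (scale-invariant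
  bounds for Type-I ancient solutions). [KochNadirashviliSereginSverak2009]
-/

noncomputable section

namespace Summit.NavierStokesRegularity.NavierStokesRegularity.Theorems.FrequencyRigidity.TwoEndedPinning

open Literature.Analysis.FluidPDE MeasureTheory Set Filter Topology Function
open scoped RealInnerProductSpace Laplacian ContDiff

/-! ### Joint smoothness of the vorticity and of `φ = ‖curl v‖²` -/

section Smooth

variable {S : Set ℝ} {v : ℝ → EuclideanSpace ℝ (Fin 3) → EuclideanSpace ℝ (Fin 3)}

/-- The vorticity `(t, x) ↦ curl v(t, x)` of a jointly smooth velocity field is jointly smooth on a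
time set of unique differentiability (`curl = curlCLM ∘ D` and the slice derivative of a jointly
smooth field is jointly smooth). [folklore] -/
theorem isSmoothSpaceTimeOn_curl (hv : IsSmoothSpaceTimeOn S v) (hS : UniqueDiffOn ℝ S) :
    IsSmoothSpaceTimeOn S fun t x => curl (v t) x := by
  have e : (fun t x => curl (v t) x) = fun t x => curlCLM (fderiv ℝ (v t) x) := by
    funext t x
    exact curl_eq_curlCLM _ _
  rw [e]
  exact (hv.fderiv_slice hS).clm_comp curlCLM

/-- `φ(t, x) = ‖curl v(t, x)‖²` is jointly smooth on a time set of unique differentiability, for a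
jointly smooth velocity field (`‖·‖²` is smooth on an inner product space). [folklore] -/
theorem isSmoothSpaceTimeOn_norm_curl_sq (hv : IsSmoothSpaceTimeOn S v) (hS : UniqueDiffOn ℝ S) :
    IsSmoothSpaceTimeOn S fun t x => ‖curl (v t) x‖ ^ 2 := by
  have h := isSmoothSpaceTimeOn_curl hv hS
  unfold IsSmoothSpaceTimeOn at h ⊢
  exact (contDiff_norm_sq ℝ).comp_contDiffOn h

/-- **`∂ₜ‖ω‖² = 2⟪ω, curl ∂ₜv⟫` on the open past.**  For a velocity field jointly smooth on
`(−∞, 0) × ℝ³`, `t < 0` and `x`, the time line `s ↦ ‖curl v(s, x)‖²` has derivative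
`2⟪curl v(t, x), curl (∂ₜv(t, ·))(x)⟫` at `t` (exchange of `∂ₜ` and `D`,
`IsSmoothSpaceTimeOn.hasDerivAt_fderiv_slice_clm`, composed with `curlCLM` and `‖·‖²`). [folklore] -/
theorem deriv_norm_curl_sq_eq (hv : IsSmoothSpaceTimeOn (Iio 0) v) {t : ℝ} (ht : t < 0)
    (x : EuclideanSpace ℝ (Fin 3)) :
    deriv (fun s => ‖curl (v s) x‖ ^ 2) t =
      2 * ⟪curl (v t) x, curl (timeDerivWithin (Iio 0) v t) x⟫ := by
  have ht' : t ∈ Iio (0 : ℝ) := ht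
  have h1 : HasDerivAt (fun s => fderiv ℝ (v s) x)
      (fderiv ℝ (fun y => deriv (fun s => v s y) t) x) t :=
    hv.hasDerivAt_fderiv_slice_clm isOpen_Iio ht' x
  have h2 : HasDerivAt (fun s => curl (v s) x) (curl (timeDerivWithin (Iio 0) v t) x) t := by
    have h := curlCLM.hasFDerivAt.comp_hasDerivAt t h1
    have e : (⇑curlCLM ∘ fun s => fderiv ℝ (v s) x) = fun s => curl (v s) x :=
      funext fun s => (curl_eq_curlCLM (v s) x).symm
    rw [e] at h
    rw [timeDerivWithin_eq_deriv_of_isOpen_subset isOpen_Iio Subset.rfl ht' v, curl_eq_curlCLM]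
    exact h
  exact h2.norm_sq.deriv

end Smooth

/-! ### Pointwise bounds for `Dφ`, `Δφ`, `∂ₜφ` -/

section Pointwise

variable {w : EuclideanSpace ℝ (Fin 3) → EuclideanSpace ℝ (Fin 3)} {x : EuclideanSpace ℝ (Fin 3)}

/-- `‖D(‖w‖²)(x)‖ ≤ 2‖w(x)‖ ‖Dw(x)‖` (`D‖w‖² = 2⟪w, Dw ·⟫`). [folklore] -/
theorem norm_fderiv_norm_sq_le (hw : DifferentiableAt ℝ w x) :
    ‖fderiv ℝ (fun y => ‖w y‖ ^ 2) x‖ ≤ 2 * ‖w x‖ * ‖fderiv ℝ w x‖ := by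
  rw [hw.hasFDerivAt.norm_sq.fderiv]
  calc ‖2 • (innerSL ℝ (w x)).comp (fderiv ℝ w x)‖
      ≤ 2 * ‖(innerSL ℝ (w x)).comp (fderiv ℝ w x)‖ := by
        have h : ‖2 • (innerSL ℝ (w x)).comp (fderiv ℝ w x)‖ ≤
            ((2 : ℕ) : ℝ) * ‖(innerSL ℝ (w x)).comp (fderiv ℝ w x)‖ := norm_nsmul_le
        exact_mod_cast h
    _ ≤ 2 * (‖innerSL ℝ (w x)‖ * ‖fderiv ℝ w x‖) := by
        gcongr
        exact ContinuousLinearMap.opNorm_comp_le _ _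
    _ = 2 * ‖w x‖ * ‖fderiv ℝ w x‖ := by rw [innerSL_apply_norm, mul_assoc]

/-- `|Δ‖w‖²(x)| ≤ 2‖Δw(x)‖ ‖w(x)‖ + 6‖Dw(x)‖²` for `w ∈ C²`
(`Δ‖w‖² = 2⟪Δw, w⟫ + 2|Dw|²_F`, `laplacian_inner_self_eq`, and `|Dw|²_F ≤ 3‖Dw‖²`,
`sum_sq_norm_apply_le_card_mul_sq_opNorm`). [folklore] -/
theorem abs_laplacian_norm_sq_le (hw : ContDiff ℝ 2 w) (x : EuclideanSpace ℝ (Fin 3)) :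
    |(Δ fun y => ‖w y‖ ^ 2) x| ≤ 2 * ‖(Δ w) x‖ * ‖w x‖ + 6 * ‖fderiv ℝ w x‖ ^ 2 := by
  have e : (fun y => ‖w y‖ ^ 2) = fun y => ⟪w y, w y⟫ := by
    funext y
    exact (real_inner_self_eq_norm_sq _).symm
  rw [e, laplacian_inner_self_eq hw x]
  have h1 : |2 * ⟪(Δ w) x, w x⟫| ≤ 2 * ‖(Δ w) x‖ * ‖w x‖ := by
    rw [abs_mul, abs_two, mul_assoc]
    exact mul_le_mul_of_nonneg_left (abs_real_inner_le_norm _ _) zero_le_two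
  have h2 : |2 * frobeniusNormSq (fderiv ℝ w x)| ≤ 6 * ‖fderiv ℝ w x‖ ^ 2 := by
    have h0 := frobeniusNormSq_nonneg (fderiv ℝ w x)
    rw [abs_of_nonneg (by positivity)]
    -- `|Dw|²_F ≤ 3‖Dw‖²` (three columns, each of norm at most `‖Dw‖`)
    have h3 : frobeniusNormSq (fderiv ℝ w x) ≤ 3 * ‖fderiv ℝ w x‖ ^ 2 := by
      rw [frobeniusNormSq_eq_sum (EuclideanSpace.basisFun (Fin 3) ℝ)]
      simpa using
        sum_sq_norm_apply_le_card_mul_sq_opNorm (EuclideanSpace.basisFun (Fin 3) ℝ) (fderiv ℝ w x)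
    linarith
  exact (abs_add_le _ _).trans (add_le_add h1 h2)

/-- `|⟪z, ν a − L u + L' z⟫| ≤ ‖z‖ (|ν| ‖a‖ + ‖L‖ ‖u‖ + ‖L'‖ ‖z‖)` — the shape of `⟪ω, ∂ₜω⟫` after
inserting the vorticity equation (`z = ω`, `a = Δω`, `u = v`, `L = Dω`, `L' = Dv`). [folklore] -/
theorem abs_inner_smul_sub_add_le (ν : ℝ) (a u z : EuclideanSpace ℝ (Fin 3))
    (L L' : EuclideanSpace ℝ (Fin 3) →L[ℝ] EuclideanSpace ℝ (Fin 3)) :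
    |⟪z, ν • a - L u + L' z⟫| ≤ ‖z‖ * (|ν| * ‖a‖ + ‖L‖ * ‖u‖ + ‖L'‖ * ‖z‖) := by
  refine (abs_real_inner_le_norm _ _).trans (mul_le_mul_of_nonneg_left ?_ (norm_nonneg _))
  calc ‖ν • a - L u + L' z‖
      ≤ ‖ν • a‖ + ‖L u‖ + ‖L' z‖ :=
        (norm_add_le _ _).trans (add_le_add (norm_sub_le _ _) le_rfl)
    _ ≤ |ν| * ‖a‖ + ‖L‖ * ‖u‖ + ‖L'‖ * ‖z‖ := by
        rw [norm_smul, Real.norm_eq_abs]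
        exact add_le_add (add_le_add le_rfl (ContinuousLinearMap.le_opNorm _ _))
          (ContinuousLinearMap.le_opNorm _ _)

end Pointwise

section Flow

variable {ν C : ℝ} {C' : ℕ → ℝ} {v : ℝ → EuclideanSpace ℝ (Fin 3) → EuclideanSpace ℝ (Fin 3)}
  {q : ℝ → EuclideanSpace ℝ (Fin 3) → ℝ}

/-- `|∂ₜ‖ω‖²| ≤ 2‖ω‖ (|ν| ‖Δω‖ + ‖Dω‖ ‖v‖ + ‖Dv‖ ‖ω‖)` for a classical Navier–Stokes flow with zero
force on the open past: `∂ₜ‖ω‖² = 2⟪ω, curl ∂ₜv⟫` and the vorticity equation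
`curl ∂ₜv = νΔω − (v·∇)ω + (ω·∇)v` (Majda–Bertozzi (1.33)). [cite: MajdaBertozziCUP2002, §1.1 and eq. (1.33)] -/
theorem abs_deriv_norm_curl_sq_le (hNS : IsClassicalNSSolutionOn (Iio 0) ν 0 v q) {t : ℝ}
    (ht : t < 0) (x : EuclideanSpace ℝ (Fin 3)) :
    |deriv (fun s => ‖curl (v s) x‖ ^ 2) t| ≤
      2 * ‖curl (v t) x‖ * (|ν| * ‖(Δ (curl (v t))) x‖ +
        ‖fderiv ℝ (curl (v t)) x‖ * ‖v t x‖ + ‖fderiv ℝ (v t) x‖ * ‖curl (v t) x‖) := by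
  have ht' : t ∈ Iio (0 : ℝ) := ht
  rw [deriv_norm_curl_sq_eq hNS.smooth_velocity ht x,
    hNS.curl_timeDerivWithin_eq isOpen_Iio.uniqueDiffOn ht' x]
  simp only [Pi.zero_apply, curl_zero, add_zero, convect_apply]
  rw [abs_mul, abs_two, mul_assoc]
  refine mul_le_mul_of_nonneg_left ?_ zero_le_two
  -- `exact` would time out unifying the `ℝ`-order instances; `convert` localises the check
  convert abs_inner_smul_sub_add_le ν ((Δ (curl (v t))) x) (v t x) (curl (v t) x)
    (fderiv ℝ (curl (v t)) x) (fderiv ℝ (v t) x) using 3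

/-! ### Slab bounds from the Type-I and scale-invariant bounds -/

/-- On a slab `[a, b] ⊂ (−∞, 0)` the time-Type-I bound gives `‖v(t, x)‖ ≤ |C|/√(−b)`. [folklore] -/
theorem slab_bound_velocity (hTI : HasTypeITimeDecay C v) {a b : ℝ} (hb : b < 0) :
    ∃ M : ℝ, 0 ≤ M ∧ ∀ t ∈ Icc a b, ∀ x : EuclideanSpace ℝ (Fin 3), ‖v t x‖ ≤ M := by
  refine ⟨|C| / Real.sqrt (-b), div_nonneg (abs_nonneg _) (Real.sqrt_nonneg _),
    fun t ht x => ?_⟩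
  have ht0 : t < 0 := lt_of_le_of_lt ht.2 hb
  have hsb : 0 < Real.sqrt (-b) := Real.sqrt_pos.2 (neg_pos.2 hb)
  calc ‖v t x‖ ≤ C / Real.sqrt (-t) := hTI t ht0 x
    _ ≤ |C| / Real.sqrt (-t) := div_le_div_of_nonneg_right (le_abs_self C) (Real.sqrt_nonneg _)
    _ ≤ |C| / Real.sqrt (-b) :=
        div_le_div_of_nonneg_left (abs_nonneg C) hsb (Real.sqrt_le_sqrt (neg_le_neg ht.2))

/-- On a slab `[a, b] ⊂ (−∞, 0)` the scale-invariant bound of order `k ≥ 1` gives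
`‖Dᵏv(t, x)‖ ≤ |C'_k| (−b)^{−(k+1)/2}` (the power `(−t)^{−(k+1)/2}` is antitone in `−t ≥ −b > 0`).
[cite: KochNadirashviliSereginSverak2009, §4 (4.10)] -/
theorem slab_bound_iteratedFDeriv
    (hD : ∀ k : ℕ, 1 ≤ k → ∀ t : ℝ, t < 0 → ∀ x : EuclideanSpace ℝ (Fin 3),
      ‖iteratedFDeriv ℝ k (v t) x‖ ≤ C' k * (-t) ^ (-((k : ℝ) + 1) / 2))
    {a b : ℝ} (hb : b < 0) {k : ℕ} (hk : 1 ≤ k) :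
    ∃ M : ℝ, 0 ≤ M ∧ ∀ t ∈ Icc a b, ∀ x : EuclideanSpace ℝ (Fin 3),
      ‖iteratedFDeriv ℝ k (v t) x‖ ≤ M := by
  have hpos : 0 < -b := neg_pos.2 hb
  refine ⟨|C' k| * (-b) ^ (-((k : ℝ) + 1) / 2),
    mul_nonneg (abs_nonneg _) (Real.rpow_nonneg hpos.le _), fun t ht x => ?_⟩
  have ht0 : t < 0 := lt_of_le_of_lt ht.2 hb
  have hle : -b ≤ -t := neg_le_neg ht.2
  have hexp : -((k : ℝ) + 1) / 2 ≤ 0 := by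
    have : (0 : ℝ) ≤ k := Nat.cast_nonneg k
    linarith
  calc ‖iteratedFDeriv ℝ k (v t) x‖ ≤ C' k * (-t) ^ (-((k : ℝ) + 1) / 2) := hD k hk t ht0 x
    _ ≤ |C' k| * (-t) ^ (-((k : ℝ) + 1) / 2) :=
        mul_le_mul_of_nonneg_right (le_abs_self _) (Real.rpow_nonneg (neg_nonneg.2 ht0.le) _)
    _ ≤ |C' k| * (-b) ^ (-((k : ℝ) + 1) / 2) :=
        mul_le_mul_of_nonneg_left (Real.rpow_le_rpow_of_nonpos hpos hle hexp) (abs_nonneg _)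

/-- **Slab bounds for `Dv`, `ω = curl v`, `Dω`, `Δω`** of a classical flow on the past with the
scale-invariant bounds: on `[a, b] × ℝ³`, `b < 0`, `‖Dv‖ ≤ M₁`, `‖ω‖ ≤ ‖curlCLM‖ M₁`,
`‖Dω‖ ≤ ‖curlCLM‖ M₂`, `‖Δω‖ ≤ 3‖curlCLM‖ M₃` with the slab bounds `Mₖ` of `‖Dᵏv‖`
(`norm_curl_le`, `norm_fderiv_curl_le`, `norm_laplacian_le_three_mul`, `norm_iteratedFDeriv_curl_le`).
[cite: KochNadirashviliSereginSverak2009, §4 (4.10)] -/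
theorem slab_bounds_vorticity (hNS : IsClassicalNSSolutionOn (Iio 0) ν 0 v q)
    (hD : ∀ k : ℕ, 1 ≤ k → ∀ t : ℝ, t < 0 → ∀ x : EuclideanSpace ℝ (Fin 3),
      ‖iteratedFDeriv ℝ k (v t) x‖ ≤ C' k * (-t) ^ (-((k : ℝ) + 1) / 2))
    {a b : ℝ} (hb : b < 0) :
    ∃ M₁ K₀ K₁ K₂ : ℝ, 0 ≤ M₁ ∧ 0 ≤ K₀ ∧ 0 ≤ K₁ ∧ 0 ≤ K₂ ∧
      ∀ t ∈ Icc a b, ∀ x : EuclideanSpace ℝ (Fin 3),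
        ‖fderiv ℝ (v t) x‖ ≤ M₁ ∧ ‖curl (v t) x‖ ≤ K₀ ∧ ‖fderiv ℝ (curl (v t)) x‖ ≤ K₁ ∧
          ‖(Δ (curl (v t))) x‖ ≤ K₂ := by
  obtain ⟨M₁, hM₁, h1⟩ := slab_bound_iteratedFDeriv hD hb (a := a) (le_refl 1)
  obtain ⟨M₂, hM₂, h2⟩ := slab_bound_iteratedFDeriv hD hb (a := a) one_le_two
  obtain ⟨M₃, hM₃, h3⟩ := slab_bound_iteratedFDeriv hD hb (a := a) (k := 3) (by norm_num)
  refine ⟨M₁, ‖curlCLM‖ * M₁, ‖curlCLM‖ * M₂, 3 * (‖curlCLM‖ * M₃), hM₁, by positivity,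
    by positivity, by positivity, fun t ht x => ?_⟩
  have ht0 : t < 0 := lt_of_le_of_lt ht.2 hb
  have hv : ContDiff ℝ ∞ (v t) := hNS.contDiff_velocity ht0
  have hv2 : ContDiff ℝ 2 (v t) := contDiff_infty.1 hv 2
  have hv3 : ContDiff ℝ 3 (v t) := contDiff_infty.1 hv 3
  have hDv : ‖fderiv ℝ (v t) x‖ ≤ M₁ := by
    rw [← norm_iteratedFDeriv_one]
    exact h1 t ht x
  refine ⟨hDv, ?_, ?_, ?_⟩
  · exact (norm_curl_le _ _).trans (mul_le_mul_of_nonneg_left hDv (norm_nonneg curlCLM))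
  · exact (norm_fderiv_curl_le hv2 x).trans
      (mul_le_mul_of_nonneg_left (h2 t ht x) (norm_nonneg curlCLM))
  · calc ‖(Δ (curl (v t))) x‖ ≤ 3 * ‖iteratedFDeriv ℝ 2 (curl (v t)) x‖ :=
          norm_laplacian_le_three_mul _ _
      _ ≤ 3 * (‖curlCLM‖ * ‖iteratedFDeriv ℝ 3 (v t) x‖) := by
          gcongr
          exact norm_iteratedFDeriv_curl_le (n := 2) (by exact_mod_cast hv3) x
      _ ≤ 3 * (‖curlCLM‖ * M₃) := by
          gcongr
          exact h3 t ht x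

/-! ### The stub -/

/-- **Stub `stub_vorticitySqBounds` (crux `FrequencyRigidity`, line `two-ended-pinning`).**  For a
classical Navier–Stokes flow `(v, q)` (viscosity `ν`, zero force) on `(−∞, 0) × ℝ³` with the
time-Type-I bound `‖v(t, x)‖ ≤ C/√(−t)` and the scale-invariant bounds
`‖Dᵏv(t, x)‖ ≤ C'_k (−t)^{−(k+1)/2}` (`k ≥ 1`), the density `φ(t, x) = ‖curl v(t, x)‖²` is jointly
smooth on `(−∞, 0) × ℝ³`, and on every slab `[a, b] × ℝ³` with `a < b < 0` the quantities `|φ|`,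
`‖Dφ‖`, `|Δφ|`, `|∂ₜφ|` are bounded by one constant (vorticity equation, Majda–Bertozzi (1.33);
scale-invariant bounds, KNSS 2009 §4). [cite: MajdaBertozziCUP2002, §1.1 and eq. (1.33)] -/
theorem stub_vorticitySqBounds :
  ∀ (ν C : ℝ) (C' : ℕ → ℝ) (v : ℝ → EuclideanSpace ℝ (Fin 3) → EuclideanSpace ℝ (Fin 3))
    (q : ℝ → EuclideanSpace ℝ (Fin 3) → ℝ),
    Literature.Analysis.FluidPDE.IsClassicalNSSolutionOn (Set.Iio 0) ν 0 v q →
    Literature.Analysis.FluidPDE.HasTypeITimeDecay C v →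
    (∀ k : ℕ, 1 ≤ k → ∀ t : ℝ, t < 0 → ∀ x : EuclideanSpace ℝ (Fin 3),
        ‖iteratedFDeriv ℝ k (v t) x‖ ≤ C' k * (-t) ^ (-((k : ℝ) + 1) / 2)) →
    Literature.Analysis.FluidPDE.IsSmoothSpaceTimeOn (Set.Iio 0)
        (fun t x => ‖Literature.Analysis.FluidPDE.curl (v t) x‖ ^ 2) ∧
      ∀ a b : ℝ, a < b → b < 0 → ∃ B : ℝ, ∀ t ∈ Set.Icc a b, ∀ x : EuclideanSpace ℝ (Fin 3),
        |‖Literature.Analysis.FluidPDE.curl (v t) x‖ ^ 2| ≤ B ∧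
          ‖fderiv ℝ (fun y => ‖Literature.Analysis.FluidPDE.curl (v t) y‖ ^ 2) x‖ ≤ B ∧
          |Laplacian.laplacian (fun y => ‖Literature.Analysis.FluidPDE.curl (v t) y‖ ^ 2) x| ≤ B ∧
          |deriv (fun s => ‖Literature.Analysis.FluidPDE.curl (v s) x‖ ^ 2) t| ≤ B := by
  intro ν C C' v q hNS hTI hD
  refine ⟨isSmoothSpaceTimeOn_norm_curl_sq hNS.smooth_velocity isOpen_Iio.uniqueDiffOn,
    fun a b _hab hb => ?_⟩
  obtain ⟨M₀, hM₀, h0⟩ := slab_bound_velocity hTI hb (a := a)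
  obtain ⟨M₁, K₀, K₁, K₂, hM₁, hK₀, hK₁, hK₂, hK⟩ := slab_bounds_vorticity hNS hD hb (a := a)
  refine ⟨K₀ ^ 2 + 2 * K₀ * K₁ + (2 * K₂ * K₀ + 6 * K₁ ^ 2)
      + 2 * K₀ * (|ν| * K₂ + K₁ * M₀ + M₁ * K₀), fun t ht x => ?_⟩
  have ht0 : t < 0 := lt_of_le_of_lt ht.2 hb
  obtain ⟨hDv, hw0, hw1, hw2⟩ := hK t ht x
  have hv : ContDiff ℝ ∞ (v t) := hNS.contDiff_velocity ht0
  have hv3 : ContDiff ℝ 3 (v t) := contDiff_infty.1 hv 3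
  have hc2 : ContDiff ℝ 2 (curl (v t)) := contDiff_curl (n := 2) (by exact_mod_cast hv3)
  have hcd : DifferentiableAt ℝ (curl (v t)) x := (hc2.differentiable two_ne_zero) x
  have hvx : ‖v t x‖ ≤ M₀ := h0 t ht x
  -- nonnegativity of the four partial bounds
  have hB1 : 0 ≤ K₀ ^ 2 := sq_nonneg _
  have hB2 : 0 ≤ 2 * K₀ * K₁ := by positivity
  have hB3 : 0 ≤ 2 * K₂ * K₀ + 6 * K₁ ^ 2 := by positivity
  have hB4 : 0 ≤ 2 * K₀ * (|ν| * K₂ + K₁ * M₀ + M₁ * K₀) := by positivity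
  -- the four bounds
  have b1 : |‖curl (v t) x‖ ^ 2| ≤ K₀ ^ 2 := by
    rw [abs_of_nonneg (sq_nonneg _)]
    exact pow_le_pow_left₀ (norm_nonneg _) hw0 2
  have b2 : ‖fderiv ℝ (fun y => ‖curl (v t) y‖ ^ 2) x‖ ≤ 2 * K₀ * K₁ := by
    refine (norm_fderiv_norm_sq_le hcd).trans ?_
    have := norm_nonneg (curl (v t) x)
    have := norm_nonneg (fderiv ℝ (curl (v t)) x)
    gcongr
  have b3 : |(Δ fun y => ‖curl (v t) y‖ ^ 2) x| ≤ 2 * K₂ * K₀ + 6 * K₁ ^ 2 := by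
    refine (abs_laplacian_norm_sq_le hc2 x).trans ?_
    have := norm_nonneg (curl (v t) x)
    have := norm_nonneg (fderiv ℝ (curl (v t)) x)
    have := norm_nonneg ((Δ (curl (v t))) x)
    gcongr
  have b4 : |deriv (fun s => ‖curl (v s) x‖ ^ 2) t| ≤
      2 * K₀ * (|ν| * K₂ + K₁ * M₀ + M₁ * K₀) := by
    refine (abs_deriv_norm_curl_sq_le hNS ht0 x).trans ?_
    have := norm_nonneg (curl (v t) x)
    have := norm_nonneg (fderiv ℝ (curl (v t)) x)
    have := norm_nonneg ((Δ (curl (v t))) x)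
    have := norm_nonneg (v t x)
    have := norm_nonneg (fderiv ℝ (v t) x)
    gcongr
  exact ⟨b1.trans (by linarith), b2.trans (by linarith), b3.trans (by linarith),
    b4.trans (by linarith)⟩

end Flow

end Summit.NavierStokesRegularity.NavierStokesRegularity.Theorems.FrequencyRigidity.TwoEndedPinning

end
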